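import Mathlib
import HarnessLib
import Summits.HubbardSuperconductivity.HubbardSuperconductivity.Theorems.KLProgrammeRadialMassSharp
import Summits.HubbardSuperconductivity.HubbardSuperconductivity.Theorems.KLProgrammeRungCutoffAlgebra
import Summits.HubbardSuperconductivity.HubbardSuperconductivity.Theorems.KLProgrammeForwardBubblePlanar

/-!
# Route `KLProgramme` — crux K3, ENGINE child (`KLRegimeEngineV14`, stmt-HubbardSuperconductivity-19918), stub `stub_engine_step_values`
# (E2-v9) (m)/(neg), (E2″): the SHARP sign-blind mass of a radial profile on the frame band — planar form (angle integration of the ray bound)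
# (cell gate-hubbard-kl, seat hubbard-kl-k3c2-p2 «thermal-bar induction n ≤ nScales β + 1»)

`…RadialMassSharp` (`klrm_*`) bounds, per ray of the frame-band coarea, the Matsubara-summed sign-blind mass of a radial integrand `F(s)/s`
(`s = ω² + e²`) against an insertion `‖W‖ ≤ B_W` by `B_W·(½∫_{s>0}‖F‖/s + thermal)`.  Here the insertion is the coarea's own
`W_θ = 𝒥_E(θ,·)·A(ray point)` (`klfb_weight`, `‖W_θ‖ ≤ A₀·π√2/(Dt_min − κ₁)` by `klfb_weight_norm_le`), the ray identity is `klfb_ray_integral_eq`,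
and the angle is integrated by `klry_norm_smul_sum_integral_le_of_ray_bound`:

* `klrp_continuous_integrand`, `klrp_integrand_support` — the planar integrand `p ↦ A(p)·F(k₀² + e(p)²)/(k₀² + e(p)²)` (`e = klfb_band δ μ`);
* `klrp_ray_integral_eq` — one ray in level coordinates: `∫_{t>0} t•h(t cos θ, t sin θ) = ∫ W_θ(e)·F(k₀²+e²)/(k₀²+e²) de`;
* **`klrp_planar_mass_norm_le`** — `‖β⁻¹ • Σ_i ∫ d²p A(p)·F(s_i(p))/s_i(p)‖ ≤ 2π·(A₀π√2/d)·(½∫_{s>0}‖F‖/s + (1024/π)(4ℓ+16M_F)·(π/β)/Λ_n)`,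
  `s_i(p) = ω_i² + e(p)²`, `d = Dt_min − κ₁`, at `n ≤ n_β + 1`;
* `klrp_planar_mass_norm_le_of_frameOK` — the `FrameOK` instance (`δ_K = frameShift K ∘ toLp`, `κ₀ = κ₁ = 4A`, `klrk_*`);
* **`klrp_planar_sameSlice_mass_le`** — the same-slice rung `F = w_n·w_n` (`klwt_*`, `M_F = 1`, `ℓ = 68/3`; `∫w_n²/s ≤ log 64`, `klrc_*`):
  `≤ 2π·(A₀π√2/d)·(½·log 64 + (1024/π)·(320/3)·(π/β)/Λ_n)` — per unit `(2π)²` of `d²p/(2π)²` this is `(A₀π√2/d)·(log 64)/(4π) + thermal ≈ 0.33·A₀·B_J`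
  mid-ladder, replacing the count × count and sup × box sizes (`kled_mass_le_card_mul_card`, `klsb2_*`) in the (m) line of (E2-v9).

The lattice step (`TorusSite 2 L`, `+ 32Λ_n K/L`) is `klfl_matsubara_latticeAverage_norm_le_scale` applied to the planar bound, as for `klfb_*`.
Pure analysis; nothing about the model is asserted.
-/

noncomputable section

namespace Summit.HubbardSuperconductivity.HubbardSuperconductivity.Theorems.KLRegimeSplit

set_option linter.dupNamespace false -- summit = problem name (single-conjunct summit), D-0017

open Real Set Filter MeasureTheory intervalIntegral Complex Literature.MathematicalPhysics.QuantumLattice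
open Literature.MathematicalPhysics.QuantumLattice.BandSectorCounting Literature.Probability.LatticeModels
open Summit.HubbardSuperconductivity.HubbardSuperconductivity.Theorems.PerturbedFermiCurve
open Summit.HubbardSuperconductivity.HubbardSuperconductivity.Theorems.KLProgrammeLegKernels
open Summit.HubbardSuperconductivity.HubbardSuperconductivity.Theorems.DispersionFlow

/-! ## §1 The planar sign-blind integrand: continuity and support -/

/-- A complex `L`-Lipschitz function of a real variable is continuous. -/
theorem klrp_continuous_of_lipschitz {g : ℝ → ℂ} {L : ℝ} (hlip : ∀ s s', ‖g s - g s'‖ ≤ L * |s - s'|) : Continuous g := by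
  have hL : 0 ≤ L := by
    have := hlip 0 1; have h0 : (0:ℝ) ≤ ‖g 0 - g 1‖ := norm_nonneg _; norm_num at this; linarith
  have hl : LipschitzWith (Real.toNNReal L) g := LipschitzWith.of_dist_le_mul fun t t' => by
    rw [dist_eq_norm, Real.dist_eq, Real.coe_toNNReal L hL]
    exact hlip t t'
  exact hl.continuous

/-- `s ↦ F(s)/s` is continuous for a Lipschitz, bounded weight vanishing near `s = 0` (`klsp_div_lipschitz`). -/
theorem klrp_continuous_div {F : ℝ → ℂ} {LF MF r₁ : ℝ} (hlip : ∀ s s', ‖F s - F s'‖ ≤ LF * |s - s'|) (hbd : ∀ s, ‖F s‖ ≤ MF)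
    (hin : ∀ s, s ≤ r₁ ^ 2 → F s = 0) (hr₁ : 0 < r₁) : Continuous fun s : ℝ => F s / ((s : ℝ) : ℂ) :=
  klrp_continuous_of_lipschitz (klsp_div_lipschitz hlip hbd hin hr₁)

variable {δ : (Fin 2 → ℝ) → ℝ}

/-- **Continuity of the planar integrand** `p ↦ A(p)·F(k₀² + e(p)²)/(k₀² + e(p)²)`. -/
theorem klrp_continuous_integrand (hδc : Continuous δ) {A : ℝ × ℝ → ℂ} (hA : Continuous A) {F : ℝ → ℂ} {LF MF r₁ : ℝ}
    (hlip : ∀ s s', ‖F s - F s'‖ ≤ LF * |s - s'|) (hbd : ∀ s, ‖F s‖ ≤ MF) (hin : ∀ s, s ≤ r₁ ^ 2 → F s = 0) (hr₁ : 0 < r₁)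
    (μ k₀ : ℝ) :
    Continuous fun p : ℝ × ℝ =>
      A p * (F (k₀ ^ 2 + klfb_band δ μ p ^ 2) / (((k₀ ^ 2 + klfb_band δ μ p ^ 2 : ℝ)) : ℂ)) :=
  hA.mul ((klrp_continuous_div hlip hbd hin hr₁).comp (continuous_const.add ((klfb_continuous_band hδc μ).pow 2)))

/-- **Support of the planar integrand**: in the open square (from `A`) and in the tube `|e| < r` (from `F(s) = 0` for `s ≥ r²`). -/
theorem klrp_integrand_support {A : ℝ × ℝ → ℂ} (hAsupp : ∀ p : ℝ × ℝ, A p ≠ 0 → |p.1| < π ∧ |p.2| < π) {F : ℝ → ℂ} {r : ℝ}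
    (hr : 0 ≤ r) (hout : ∀ s, r ^ 2 ≤ s → F s = 0) (μ k₀ : ℝ) (p : ℝ × ℝ)
    (hp : A p * (F (k₀ ^ 2 + klfb_band δ μ p ^ 2) / (((k₀ ^ 2 + klfb_band δ μ p ^ 2 : ℝ)) : ℂ)) ≠ 0) :
    |p.1| < π ∧ |p.2| < π ∧ |klfb_band δ μ p| < r := by
  have hA : A p ≠ 0 := fun h => hp (by rw [h, zero_mul])
  have hF : F (k₀ ^ 2 + klfb_band δ μ p ^ 2) ≠ 0 := fun h => hp (by rw [h, zero_div, mul_zero])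
  have hlt : k₀ ^ 2 + klfb_band δ μ p ^ 2 < r ^ 2 := by
    by_contra hge
    exact hF (hout _ (not_lt.1 hge))
  refine ⟨(hAsupp p hA).1, (hAsupp p hA).2, ?_⟩
  exact abs_lt_of_sq_lt_sq (by nlinarith [sq_nonneg k₀]) hr

section Frame

variable {a b : ℝ} (B : BandBounds a b) (hδ1 : ContDiff ℝ 1 δ) {κ₀ κ₁ : ℝ}
  (hδ : ∀ k : Fin 2 → ℝ, (∀ i, |k i| ≤ π) → |δ k| ≤ κ₀)
  (hκ : ∀ k : Fin 2 → ℝ, (∀ i, |k i| ≤ π) → ‖fderiv ℝ δ k‖ ≤ κ₁) (hκ₁ : κ₁ < B.Dtmin)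

/-! ## §2 One ray in level coordinates -/

include B hδ1 hδ hκ hκ₁ in
/-- **The sign-blind integrand on one ray, in level coordinates**: with `F(s) = 0` for `s ≥ r²` and the margin window `a < μ − r − κ₀`,
`μ + r + κ₀ < b`:  `∫_{t>0} t • h(t cos θ, t sin θ) dt = ∫ W_θ(e)·F(k₀²+e²)/(k₀²+e²) de` (`W_θ = klfb_weight δ μ A θ`). -/
theorem klrp_ray_integral_eq {A : ℝ × ℝ → ℂ} (hA : Continuous A) (hAsupp : ∀ p : ℝ × ℝ, A p ≠ 0 → |p.1| < π ∧ |p.2| < π)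
    {F : ℝ → ℂ} {LF MF r₁ r : ℝ} (hlip : ∀ s s', ‖F s - F s'‖ ≤ LF * |s - s'|) (hbd : ∀ s, ‖F s‖ ≤ MF)
    (hin : ∀ s, s ≤ r₁ ^ 2 → F s = 0) (hout : ∀ s, r ^ 2 ≤ s → F s = 0) (hr₁ : 0 < r₁) (hr : 0 < r)
    {μ : ℝ} (hlo : a < μ - r - κ₀) (hhi : μ + r + κ₀ < b) (k₀ θ : ℝ) :
    ∫ t in Ioi (0 : ℝ), t • (A (t * Real.cos θ, t * Real.sin θ) *
        (F (k₀ ^ 2 + klfb_band δ μ (t * Real.cos θ, t * Real.sin θ) ^ 2) /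
          (((k₀ ^ 2 + klfb_band δ μ (t * Real.cos θ, t * Real.sin θ) ^ 2 : ℝ)) : ℂ))) =
      ∫ e : ℝ, klfb_weight δ μ A θ e * (F (k₀ ^ 2 + e ^ 2) / (((k₀ ^ 2 + e ^ 2 : ℝ)) : ℂ)) := by
  have hδc : Continuous δ := hδ1.continuous
  have hc := klrp_continuous_integrand (δ := δ) hδc hA hlip hbd hin hr₁ μ k₀
  rw [klfb_ray_integral_eq B hδ1 hδ hκ hκ₁ hc hr.le hlo hhi (klrp_integrand_support hAsupp hr.le hout μ k₀) θ]
  -- the integrand on the window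
  have hwin : ∀ e ∈ uIcc (-r) r, klfb_jac δ μ θ e • (A (klfb_rayPt δ μ θ e) *
      (F (k₀ ^ 2 + klfb_band δ μ (klfb_rayPt δ μ θ e) ^ 2) / (((k₀ ^ 2 + klfb_band δ μ (klfb_rayPt δ μ θ e) ^ 2 : ℝ)) : ℂ))) =
      klfb_weight δ μ A θ e * (F (k₀ ^ 2 + e ^ 2) / (((k₀ ^ 2 + e ^ 2 : ℝ)) : ℂ)) := by
    intro e he
    rw [uIcc_of_le (by linarith)] at he
    have hlo' : a ≤ μ + e - κ₀ := by linarith [he.1]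
    have hhi' : μ + e + κ₀ ≤ b := by linarith [he.2]
    unfold klfb_weight
    rw [klfb_band_rayPt B hδ hδc hlo' hhi' θ, Complex.real_smul]
    ring
  rw [intervalIntegral.integral_congr hwin]
  -- the integrand vanishes off the window
  refine intervalIntegral.integral_eq_integral_of_support_subset fun e he => ?_
  by_contra hnot
  apply he
  have hge : r ≤ |e| := by
    by_contra hlt
    push Not at hlt
    exact hnot ⟨by linarith [neg_abs_le e], (le_abs_self e).trans hlt.le⟩
  have hz : F (k₀ ^ 2 + e ^ 2) = 0 := hout _ (by nlinarith [sq_abs e, sq_nonneg k₀, abs_nonneg e])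
  simp only [hz, zero_div, mul_zero]

/-! ## §3 The per-ray bound and the planar bound -/

include B hδ1 hδ hκ hκ₁ in
/-- **Per-ray sharp sign-blind mass on the frame band** (scale form): at `n ≤ n_β + 1`, for a weight product `F` on the slice shell
(`‖F‖ ≤ M_F`, `‖F(s) − F(s′)‖ ≤ (ℓ/Λ_n²)|s−s′|`, `F = 0` for `s ≤ (Λ_n/2)²` and `s ≥ (4Λ_n)²`), a planar weight `‖A‖ ≤ A₀` supported in the open square,
the margin window at radius `4Λ_n`, and `M ≥ 4Λ_nβ/(2π) + 1`:
`‖β⁻¹ • Σ_i ∫_{t>0} t•h_i(t cos θ, t sin θ)‖ ≤ (A₀π√2/(Dt_min − κ₁))·(½∫_{s>0}‖F‖/s + (1024/π)(4ℓ+16M_F)(π/β)/Λ_n)`. -/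
theorem klrp_ray_mass_norm_le {A : ℝ × ℝ → ℂ} (hA : Continuous A) (hAsupp : ∀ p : ℝ × ℝ, A p ≠ 0 → |p.1| < π ∧ |p.2| < π)
    {A₀ : ℝ} (hA0 : ∀ p, ‖A p‖ ≤ A₀) {F : ℝ → ℂ} {MF ℓ : ℝ} {n : ℕ} (hbd : ∀ s, ‖F s‖ ≤ MF)
    (hlip : ∀ s s', ‖F s - F s'‖ ≤ ℓ / klScale klE0 n ^ 2 * |s - s'|)
    (hin : ∀ s, s ≤ (klScale klE0 n / 2) ^ 2 → F s = 0) (hout : ∀ s, (4 * klScale klE0 n) ^ 2 ≤ s → F s = 0)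
    {μ : ℝ} (hlo : a < μ - 4 * klScale klE0 n - κ₀) (hhi : μ + 4 * klScale klE0 n + κ₀ < b)
    {β : ℝ} (hβ : klBetaMin ≤ β) (hn : n ≤ nScales β + 1) {M : ℕ} (hM : β * (4 * klScale klE0 n) / (2 * Real.pi) + 1 ≤ M) (θ : ℝ) :
    ‖β⁻¹ • ∑ i : MatsubaraIdx M, ∫ t in Ioi (0 : ℝ), t • (A (t * Real.cos θ, t * Real.sin θ) *
        (F (matsubaraFreq β M i ^ 2 + klfb_band δ μ (t * Real.cos θ, t * Real.sin θ) ^ 2) /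
          (((matsubaraFreq β M i ^ 2 + klfb_band δ μ (t * Real.cos θ, t * Real.sin θ) ^ 2 : ℝ)) : ℂ)))‖ ≤
      A₀ * (Real.pi * Real.sqrt 2 / (B.Dtmin - κ₁)) *
        (1 / 2 * (∫ s in Ioi (0 : ℝ), ‖F s‖ / s) + 1024 / Real.pi * (4 * ℓ + 16 * MF) * ((Real.pi / β) / klScale klE0 n)) := by
  have hδc : Continuous δ := hδ1.continuous
  have hΛ := klth_klScale_pos n
  have hr₁ : 0 < klScale klE0 n / 2 := by positivity
  have hr : 0 < 4 * klScale klE0 n := by positivity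
  have hA0' : 0 ≤ A₀ := (norm_nonneg _).trans (hA0 0)
  have hd : 0 < B.Dtmin - κ₁ := by linarith
  have hBW : 0 ≤ A₀ * (Real.pi * Real.sqrt 2 / (B.Dtmin - κ₁)) := by positivity
  -- rewrite every ray integral in level coordinates
  have hray : ∀ i : MatsubaraIdx M,
      ∫ t in Ioi (0 : ℝ), t • (A (t * Real.cos θ, t * Real.sin θ) *
        (F (matsubaraFreq β M i ^ 2 + klfb_band δ μ (t * Real.cos θ, t * Real.sin θ) ^ 2) /
          (((matsubaraFreq β M i ^ 2 + klfb_band δ μ (t * Real.cos θ, t * Real.sin θ) ^ 2 : ℝ)) : ℂ))) =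
      ∫ e : ℝ, klfb_weight δ μ A θ e * (F (matsubaraFreq β M i ^ 2 + e ^ 2) / (((matsubaraFreq β M i ^ 2 + e ^ 2 : ℝ)) : ℂ)) :=
    fun i => klrp_ray_integral_eq B hδ1 hδ hκ hκ₁ hA hAsupp hlip hbd hin hout hr₁ hr hlo hhi _ θ
  simp_rw [hray]
  -- the insertion `W_θ` is bounded on the window `|e| < 4Λ_n`
  have hW : ∀ e, |e| < 4 * klScale klE0 n → ‖klfb_weight δ μ A θ e‖ ≤ A₀ * (Real.pi * Real.sqrt 2 / (B.Dtmin - κ₁)) := by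
    intro e he
    have he' := abs_lt.1 he
    exact klfb_weight_norm_le B hδ hκ hκ₁ hδc hA0 (by linarith [he'.1]) (by linarith [he'.2]) θ
  exact klrm_ray_mass_norm_le_scale hbd hlip hin hout hBW hW hβ hn hM

include B hδ1 hδ hκ hκ₁ in
/-- **THE SHARP SIGN-BLIND MASS OF A RADIAL PROFILE ON THE FRAME BAND (planar, discrete Matsubara sum).**  Under the hypotheses of
`klrp_ray_mass_norm_le`:
`‖β⁻¹ • Σ_i ∫ d²p A(p)·F(ω_i² + e(p)²)/(ω_i² + e(p)²)‖ ≤ 2π·(A₀π√2/(Dt_min − κ₁))·(½∫_{s>0}‖F‖/s + (1024/π)(4ℓ + 16M_F)·(π/β)/Λ_n)`. -/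
theorem klrp_planar_mass_norm_le {A : ℝ × ℝ → ℂ} (hA : Continuous A) (hAsupp : ∀ p : ℝ × ℝ, A p ≠ 0 → |p.1| < π ∧ |p.2| < π)
    {A₀ : ℝ} (hA0 : ∀ p, ‖A p‖ ≤ A₀) {F : ℝ → ℂ} {MF ℓ : ℝ} {n : ℕ} (hbd : ∀ s, ‖F s‖ ≤ MF)
    (hlip : ∀ s s', ‖F s - F s'‖ ≤ ℓ / klScale klE0 n ^ 2 * |s - s'|)
    (hin : ∀ s, s ≤ (klScale klE0 n / 2) ^ 2 → F s = 0) (hout : ∀ s, (4 * klScale klE0 n) ^ 2 ≤ s → F s = 0)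
    {μ : ℝ} (hlo : a < μ - 4 * klScale klE0 n - κ₀) (hhi : μ + 4 * klScale klE0 n + κ₀ < b)
    {β : ℝ} (hβ : klBetaMin ≤ β) (hn : n ≤ nScales β + 1) {M : ℕ} (hM : β * (4 * klScale klE0 n) / (2 * Real.pi) + 1 ≤ M) :
    ‖β⁻¹ • ∑ i : MatsubaraIdx M, ∫ p : ℝ × ℝ, A p *
        (F (matsubaraFreq β M i ^ 2 + klfb_band δ μ p ^ 2) / (((matsubaraFreq β M i ^ 2 + klfb_band δ μ p ^ 2 : ℝ)) : ℂ))‖ ≤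
      2 * Real.pi * (A₀ * (Real.pi * Real.sqrt 2 / (B.Dtmin - κ₁)) *
        (1 / 2 * (∫ s in Ioi (0 : ℝ), ‖F s‖ / s) + 1024 / Real.pi * (4 * ℓ + 16 * MF) * ((Real.pi / β) / klScale klE0 n))) := by
  have hδc : Continuous δ := hδ1.continuous
  have hΛ := klth_klScale_pos n
  have hr₁ : 0 < klScale klE0 n / 2 := by positivity
  have hr : 0 < 4 * klScale klE0 n := by positivity
  have hcs := klfb_hasCompactSupport_of_square hAsupp
  have hint : ∀ i : MatsubaraIdx M, Integrable fun p : ℝ × ℝ => A p *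
      (F (matsubaraFreq β M i ^ 2 + klfb_band δ μ p ^ 2) / (((matsubaraFreq β M i ^ 2 + klfb_band δ μ p ^ 2 : ℝ)) : ℂ)) := by
    intro i
    have hc := klrp_continuous_integrand (δ := δ) hδc hA hlip hbd hin hr₁ μ (matsubaraFreq β M i)
    exact hc.integrable_of_hasCompactSupport hcs.mul_right
  exact klry_norm_smul_sum_integral_le_of_ray_bound hint fun θ _ =>
    klrp_ray_mass_norm_le B hδ1 hδ hκ hκ₁ hA hAsupp hA0 hbd hlip hin hout hlo hhi hβ hn hM θ

end Frame

/-! ## §4 The `FrameOK` instance -/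

section FrameOK

variable {R : RenConsts} {U c β μ : ℝ} {K : TrigPolyC4v} {a b : ℝ} (B : BandBounds a b)

/-- **The sharp sign-blind planar mass for an ADMISSIBLE FRAME's band.**  For `FrameOK R U (nScales β) μ K` in the regime `klBetaMin ≤ β ≤ e^{c/U²}`
(`0 ≤ c`, `0 ≤ R.Gfr j`), `A := 2·Gfr0·|U| + 2·Gfr1·U² + Gfr2·c/log 4`, `4A < Dt_min`, margins `a < μ − 4Λ_n − 4A`, `μ + 4Λ_n + 4A < b`, and the
weight hypotheses of `klrp_planar_mass_norm_le`: the planar bound holds with `κ₁ = 4A` (`δ_K = frameShift K ∘ toLp`). -/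
theorem klrp_planar_mass_norm_le_of_frameOK (hR : ∀ j, 0 ≤ R.Gfr j) (hc : 0 ≤ c) (hβmin : klBetaMin ≤ β)
    (hβc : β ≤ Real.exp (c / U ^ 2)) (hK : FrameOK R U (nScales β) μ K)
    (hA : 4 * (2 * R.Gfr 0 * |U| + 2 * R.Gfr 1 * U ^ 2 + R.Gfr 2 * (c / Real.log 4)) < B.Dtmin)
    {Apl : ℝ × ℝ → ℂ} (hApl : Continuous Apl) (hAsupp : ∀ p : ℝ × ℝ, Apl p ≠ 0 → |p.1| < π ∧ |p.2| < π)
    {A₀ : ℝ} (hA0 : ∀ p, ‖Apl p‖ ≤ A₀) {F : ℝ → ℂ} {MF ℓ : ℝ} {n : ℕ} (hbd : ∀ s, ‖F s‖ ≤ MF)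
    (hlip : ∀ s s', ‖F s - F s'‖ ≤ ℓ / klScale klE0 n ^ 2 * |s - s'|)
    (hin : ∀ s, s ≤ (klScale klE0 n / 2) ^ 2 → F s = 0) (hout : ∀ s, (4 * klScale klE0 n) ^ 2 ≤ s → F s = 0)
    (hlo : a < μ - 4 * klScale klE0 n - 4 * (2 * R.Gfr 0 * |U| + 2 * R.Gfr 1 * U ^ 2 + R.Gfr 2 * (c / Real.log 4)))
    (hhi : μ + 4 * klScale klE0 n + 4 * (2 * R.Gfr 0 * |U| + 2 * R.Gfr 1 * U ^ 2 + R.Gfr 2 * (c / Real.log 4)) < b)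
    (hn : n ≤ nScales β + 1) {M : ℕ} (hM : β * (4 * klScale klE0 n) / (2 * Real.pi) + 1 ≤ M) :
    ‖β⁻¹ • ∑ i : MatsubaraIdx M, ∫ p : ℝ × ℝ, Apl p *
        (F (matsubaraFreq β M i ^ 2 + klfb_band (fun k : Fin 2 → ℝ => frameShift K (WithLp.toLp 2 k)) μ p ^ 2) /
          (((matsubaraFreq β M i ^ 2 + klfb_band (fun k : Fin 2 → ℝ => frameShift K (WithLp.toLp 2 k)) μ p ^ 2 : ℝ)) : ℂ))‖ ≤
      2 * Real.pi * (A₀ * (Real.pi * Real.sqrt 2 / (B.Dtmin - 4 * (2 * R.Gfr 0 * |U| + 2 * R.Gfr 1 * U ^ 2 + R.Gfr 2 * (c / Real.log 4)))) *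
        (1 / 2 * (∫ s in Ioi (0 : ℝ), ‖F s‖ / s) + 1024 / Real.pi * (4 * ℓ + 16 * MF) * ((Real.pi / β) / klScale klE0 n))) := by
  have hAb := klrk_frame_C2_bound hR hc hβmin hβc hK
  have hsm := frameShift_toLp_small hAb le_rfl
  exact klrp_planar_mass_norm_le B (contDiff_frameShift_toLp K) (fun k _ => hsm.1 k) (fun k _ => hsm.2.1 k) hA hApl hAsupp hA0 hbd hlip
    hin hout hlo hhi hβmin hn hM

end FrameOK

/-! ## §5 The same-slice rung `F = w_n·w_n` -/

section SameSlice

variable {a b : ℝ} (B : BandBounds a b) {δ : (Fin 2 → ℝ) → ℝ} (hδ1 : ContDiff ℝ 1 δ) {κ₀ κ₁ : ℝ}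
  (hδ : ∀ k : Fin 2 → ℝ, (∀ i, |k i| ≤ π) → |δ k| ≤ κ₀)
  (hκ : ∀ k : Fin 2 → ℝ, (∀ i, |k i| ≤ π) → ‖fderiv ℝ δ k‖ ≤ κ₁) (hκ₁ : κ₁ < B.Dtmin)

/-- The `ds/s`-mass of the same-slice product in the complex spelling: `∫_{s>0} ‖w_n(s)·w_n(s)‖/s ≤ log 64` (`klrc_step_masses`). -/
theorem klrp_sameSlice_norm_mass_le {n : ℕ} (hn : 1 ≤ n) :
    ∫ s in Ioi (0 : ℝ), ‖((salmhoferCutoff (s / klScale klE0 n ^ 2) - salmhoferCutoff (s / klScale klE0 (n - 1) ^ 2) : ℝ) : ℂ) *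
        ((salmhoferCutoff (s / klScale klE0 n ^ 2) - salmhoferCutoff (s / klScale klE0 (n - 1) ^ 2) : ℝ) : ℂ)‖ / s ≤ Real.log 64 := by
  have h := (klrc_step_masses hn).2.2.2
  refine le_trans (le_of_eq ?_) h
  refine setIntegral_congr_fun measurableSet_Ioi fun s _ => ?_
  rw [norm_mul, Complex.norm_real, Real.norm_eq_abs, ← sq, sq_abs]

include B hδ1 hδ hκ hκ₁ in
/-- **The same-slice sign-blind rung mass on the frame band (planar)**: at `1 ≤ n ≤ n_β + 1`, with the carrier's slice weight `w_n` (`klwt_*`: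
`M_F = 1`, `ℓ = 68/3`) and a planar weight `‖A‖ ≤ A₀` in the open square,
`‖β⁻¹ • Σ_i ∫ d²p A(p)·w_n(s)²/s‖ ≤ 2π·(A₀π√2/(Dt_min − κ₁))·(½·log 64 + (1024/π)·(320/3)·(π/β)/Λ_n)`, `s = ω_i² + e(p)²`. -/
theorem klrp_planar_sameSlice_mass_le {A : ℝ × ℝ → ℂ} (hA : Continuous A) (hAsupp : ∀ p : ℝ × ℝ, A p ≠ 0 → |p.1| < π ∧ |p.2| < π)
    {A₀ : ℝ} (hA0 : ∀ p, ‖A p‖ ≤ A₀) {n : ℕ} (hn1 : 1 ≤ n)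
    {μ : ℝ} (hlo : a < μ - 4 * klScale klE0 n - κ₀) (hhi : μ + 4 * klScale klE0 n + κ₀ < b)
    {β : ℝ} (hβ : klBetaMin ≤ β) (hn : n ≤ nScales β + 1) {M : ℕ} (hM : β * (4 * klScale klE0 n) / (2 * Real.pi) + 1 ≤ M) :
    ‖β⁻¹ • ∑ i : MatsubaraIdx M, ∫ p : ℝ × ℝ, A p *
        (((salmhoferCutoff ((matsubaraFreq β M i ^ 2 + klfb_band δ μ p ^ 2) / klScale klE0 n ^ 2) -
              salmhoferCutoff ((matsubaraFreq β M i ^ 2 + klfb_band δ μ p ^ 2) / klScale klE0 (n - 1) ^ 2) : ℝ) : ℂ) *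
            ((salmhoferCutoff ((matsubaraFreq β M i ^ 2 + klfb_band δ μ p ^ 2) / klScale klE0 n ^ 2) -
              salmhoferCutoff ((matsubaraFreq β M i ^ 2 + klfb_band δ μ p ^ 2) / klScale klE0 (n - 1) ^ 2) : ℝ) : ℂ) /
          (((matsubaraFreq β M i ^ 2 + klfb_band δ μ p ^ 2 : ℝ)) : ℂ))‖ ≤
      2 * Real.pi * (A₀ * (Real.pi * Real.sqrt 2 / (B.Dtmin - κ₁)) *
        (1 / 2 * Real.log 64 + 1024 / Real.pi * (320 / 3) * ((Real.pi / β) / klScale klE0 n))) := by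
  obtain ⟨hb, -, hin, hout⟩ := klwt_sliceWeight_hypotheses_sharp hn1
  -- the product weight `F = w·w`
  set w : ℝ → ℂ := fun s => ((salmhoferCutoff (s / klScale klE0 n ^ 2) - salmhoferCutoff (s / klScale klE0 (n - 1) ^ 2) : ℝ) : ℂ) with hw
  have hFbd : ∀ s, ‖w s * w s‖ ≤ 1 := fun s => by
    have := klwt_mul_norm_le hb hb s
    simpa [hw] using this
  have hFlip : ∀ s s', ‖w s * w s - w s' * w s'‖ ≤ (68 / 3) / klScale klE0 n ^ 2 * |s - s'| := fun s s' =>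
    klwt_sliceWeightSq_lipschitz_sharp hn1 s s'
  have hFin : ∀ s, s ≤ (klScale klE0 n / 2) ^ 2 → w s * w s = 0 := fun s hs => by simp only [hw, hin s hs, zero_mul]
  have hFout : ∀ s, (4 * klScale klE0 n) ^ 2 ≤ s → w s * w s = 0 := fun s hs => by simp only [hw, hout s hs, zero_mul]
  have hmain := klrp_planar_mass_norm_le B hδ1 hδ hκ hκ₁ hA hAsupp hA0 (F := fun s => w s * w s) hFbd hFlip hFin hFout hlo hhi hβ hn hM
  have hmass : ∫ s in Ioi (0 : ℝ), ‖w s * w s‖ / s ≤ Real.log 64 := klrp_sameSlice_norm_mass_le hn1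
  have hΛ := klth_klScale_pos n
  have hβ0 : 0 < β := pos_of_klBetaMin_le hβ
  have hd : 0 < B.Dtmin - κ₁ := by linarith
  have hA0' : 0 ≤ A₀ := (norm_nonneg _).trans (hA0 0)
  have hBW : 0 ≤ A₀ * (Real.pi * Real.sqrt 2 / (B.Dtmin - κ₁)) := by positivity
  have hnum : (4 : ℝ) * (68 / 3) + 16 * 1 = 320 / 3 := by norm_num
  refine le_trans (le_of_eq ?_) (hmain.trans ?_)
  · rfl
  · rw [hnum]
    have hth : 0 ≤ 1024 / Real.pi * (320 / 3) * ((Real.pi / β) / klScale klE0 n) := by positivity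
    have h1 : 1 / 2 * (∫ s in Ioi (0 : ℝ), ‖w s * w s‖ / s) + 1024 / Real.pi * (320 / 3) * ((Real.pi / β) / klScale klE0 n) ≤
        1 / 2 * Real.log 64 + 1024 / Real.pi * (320 / 3) * ((Real.pi / β) / klScale klE0 n) := by linarith
    exact mul_le_mul_of_nonneg_left (mul_le_mul_of_nonneg_left h1 hBW) (by positivity)

end SameSlice

end Summit.HubbardSuperconductivity.HubbardSuperconductivity.Theorems.KLRegimeSplit

end
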